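import Mathlib
import Summits.NavierStokesRegularity.NavierStokesRegularity.Theorems.FilamentSkeletonRssAnalyticStripLiaSymbolSeriesDefs

/-!
# Clause 13-J/13-R negative window, KERNEL-ONLY re-certification — DEFINITIONS (cell checker + node list)

Hand leafhand-ns-filamentskeletonrs-7 g1 (prover), 2026-08-31, `--supports stmt-NavierStokesRegularity-23612 --as helper`; by-product of the
kernel-only `LiaSymbolBound` machinery (`…AnalyticStripLiaSymbolSeriesDefs/Sound/Encl/Window`, landed for 23320's stub P3).  The window of record
`…Clause13LiaSymbolNegWindow.liaSym_le_neg_window` (`𝔖 ≤ −1/64` on `x ∈ [1/4, 19/20]`, design n1a of the model gluing) rests on `native_decide`;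
the companion file `…Clause13LiaSymbolNegWindowKernel` proves the WIDER window `x ∈ [1/5, 1]` (`p = x²/4 ∈ [1/100, 1/4]`) with standard axioms,
replaying `cellsChkNeg (1/64) nodesNeg` in the kernel.  Statement-only file: one `p`-cell `[a,b]` passes iff `1 − CLo(b) − 2a·ELo(b) ≤ −κ`
(`C`, `E` antitone; `CLo`, `ELo` the exact-ℚ series enclosures of `…SeriesDefs`).
HONEST FRAMING: certified numerics for one explicit real integral, serving a HYPOTHETICAL filament-skeleton line on the NEGATIVE side of a
MODEL route; nothing here bears on Navier–Stokes regularity or blow-up.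
-/

set_option linter.dupNamespace false

namespace Summit.NavierStokesRegularity.NavierStokesRegularity.Theorems.AnalyticStripLiaSymbol

namespace Series

/-- One negative-window `p`-cell `[a, b]`: admissible nodes and `1 − CLo(b) − 2a·ELo(b) ≤ −κ`. -/
def cellChkNeg (κ : ℚ) (a : ℚ) (ka : ℤ) (b : ℚ) (kb : ℤ) : Bool :=
  decide (0 < a) && decide (a ≤ b) && logOK a ka && logOK b kb &&
    decide (1 - CLo b kb - 2 * a * ELo b kb ≤ -κ)

/-- Chain the negative-window cell checks over consecutive nodes. -/
def cellsChkNeg (κ : ℚ) : List (ℚ × ℤ) → Bool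
  | x :: y :: rest => cellChkNeg κ x.1 x.2 y.1 y.2 && cellsChkNeg κ (y :: rest)
  | _ => true

/-- The node list `(p, k)` for `p ∈ [1/100, 1/4]` (33 nodes, chosen greedily with an exact-rational replay of this checker). -/
def nodesNeg : List (ℚ × ℤ) :=
  [((1 : ℚ) / 100, -7), ((11 : ℚ) / 1000, -6), ((3 : ℚ) / 250, -6), ((13 : ℚ) / 1000, -6), ((7 : ℚ) / 500, -6),
    ((2 : ℚ) / 125, -6), ((9 : ℚ) / 500, -6), ((21 : ℚ) / 1000, -5), ((1 : ℚ) / 40, -5), ((3 : ℚ) / 100, -5),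
    ((9 : ℚ) / 250, -5), ((11 : ℚ) / 250, -4), ((53 : ℚ) / 1000, -4), ((8 : ℚ) / 125, -4), ((19 : ℚ) / 250, -4),
    ((89 : ℚ) / 1000, -3), ((103 : ℚ) / 1000, -3), ((59 : ℚ) / 500, -3), ((133 : ℚ) / 1000, -3), ((37 : ℚ) / 250, -3),
    ((81 : ℚ) / 500, -3), ((7 : ℚ) / 40, -2), ((187 : ℚ) / 1000, -2), ((99 : ℚ) / 500, -2), ((26 : ℚ) / 125, -2),
    ((27 : ℚ) / 125, -2), ((223 : ℚ) / 1000, -2), ((229 : ℚ) / 1000, -2), ((117 : ℚ) / 500, -2), ((239 : ℚ) / 1000, -2),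
    ((243 : ℚ) / 1000, -2), ((123 : ℚ) / 500, -2), ((1 : ℚ) / 4, -2)]

end Series

end Summit.NavierStokesRegularity.NavierStokesRegularity.Theorems.AnalyticStripLiaSymbol
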